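import Literature.NumberTheory.Sieve.LargestPrimeFactorCubicSetup
import Literature.NumberTheory.Sieve.LargestPrimeFactorCubicRemainder
import HarnessLib

/-!
# Heath-Brown 2001, §5: the `c`-progressions and the partial summation removing `e(nX'/N(α))`

Fourteenth proved layer of this seat under the named fact `HeathBrown2001_largestPrimeFactor_cubic`
(`LargestPrimeFactorCubic.lean`; D. R. Heath-Brown, *The largest prime factor of `X³ + 2`*, Proc.
London Math. Soc. (3) 82 (2001) 554–596).  In §5 (pp. 571–572) the variable `c` of a family runs
over a progression, "we shall write `c = c₃(a, b, KA, r, s) + m rs N(KA)`, so that `m` runs over a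
union of at most `3` intervals, whose total length is `O(1 + N/rsN(KA))`", and the smooth factor is
removed by partial summation: "It follows from (4.1) that `∇N(x)⁻¹ ≪ N(x)^{−4/3}` (5.2), whence
`(d/dt) N(a + b∛2 + t∛4)⁻¹ ≪ N(α)^{−4/3} ≪ M⁻⁴` (5.3). This estimate allows us to conclude, by partial
summation, that `σ(n) ≪ (1 + nXNM⁻⁴)|∑_{B'<m≤B'+B} e_{q'}(w ḡ(m))|` … Since `XNM⁻⁴ ≤ 1`, by (2.6),
this implies that `σ(n) ≪ n |∑ …|`."  This file PROVES the tools for these two steps in our setting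
(one cube of side `t/100`, so each progression is a single interval):

* `norm_sum_range_mul_le` — Abel's inequality: if all partial sums of `w` are `≤ M` in norm,
  `|φ| ≤ 1` and `∑ |φ(k+1) − φ(k)| ≤ V`, then `|∑_{k<B} φ(k) w(k)| ≤ (1 + V) M`;
  `sum_Ioc_eq_sum_range` — `∑_{A<m≤A+n} F(m) = ∑_{k<n} F(A+k+1)` (to match Theorem 2's ranges);
* `filter_dvd_eq_image` — the `c ∈ (t/10, 0.11t]` in one class modulo `L` are `c_min + Lk`,
  `k < B`, with `(B − 1)L < t/100` (`card_progression_le` : `B ≤ t/(100L) + 1`);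
* `abs_normf_sub_le` — `|N(a,b,c') − N(a,b,c)| ≤ t²|c' − c|` in the cube, and
  `tv_phase_le` — for `Φ(k) = e(hY/N(a,b,c_k))`, `Y ≤ 2X`, `t³ ≥ X`:
  `∑_{k} |Φ(k+1) − Φ(k)| ≤ (3/20)|h|` (Heath-Brown's `1 + nXNM⁻⁴ ≪ n`).

## References

* D. R. Heath-Brown, *The largest prime factor of `X³ + 2`*, Proc. London Math. Soc. (3) 82 (2001)
  554–596, §5 pp. 571–572 ((5.2)–(5.3)). [`HeathBrown2001LargestPrimeFactorCubic`]
-/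

noncomputable section

open Finset Real
open scoped FourierTransform

namespace Literature.NumberTheory.Sieve.LargestPrimeFactorCubic

/-! ### Abel's inequality -/

/-- **Summation by parts**: `∑_{k<B} φ(k) w(k) = φ(B−1) S(B) − ∑_{k<B−1} (φ(k+1) − φ(k)) S(k+1)`,
`S(n) = ∑_{k<n} w(k)`, for `B ≥ 1`. [folklore] -/
theorem sum_range_mul_eq_abel (B : ℕ) (hB : 1 ≤ B) (φ w : ℕ → ℂ) :
    ∑ k ∈ range B, φ k * w k =
      φ (B - 1) * ∑ k ∈ range B, w k -
        ∑ k ∈ range (B - 1), (φ (k + 1) - φ k) * ∑ i ∈ range (k + 1), w i := by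
  induction B, hB using Nat.le_induction with
  | base => simp
  | succ B hB ih =>
      rw [sum_range_succ, ih, show B + 1 - 1 = B from rfl, show B = (B - 1) + 1 from by omega,
        sum_range_succ (fun k => (φ (k + 1) - φ k) * ∑ i ∈ range (k + 1), w i)]
      rw [show B - 1 + 1 = B from by omega, sum_range_succ w B]
      ring

/-- **Abel's inequality**: if `|∑_{k<n} w(k)| ≤ M` for all `n ≤ B`, `|φ(k)| ≤ 1`, and
`∑_{k<B−1} |φ(k+1) − φ(k)| ≤ V`, then `|∑_{k<B} φ(k) w(k)| ≤ (1 + V) M`.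
[cite: HeathBrown2001LargestPrimeFactorCubic, §5 p. 572 ("by partial summation")] -/
theorem norm_sum_range_mul_le (B : ℕ) (φ w : ℕ → ℂ) {M V : ℝ} (hM0 : 0 ≤ M)
    (hM : ∀ n ≤ B, ‖∑ k ∈ range n, w k‖ ≤ M) (hφ : ∀ k, ‖φ k‖ ≤ 1)
    (hV : ∑ k ∈ range (B - 1), ‖φ (k + 1) - φ k‖ ≤ V) :
    ‖∑ k ∈ range B, φ k * w k‖ ≤ (1 + V) * M := by
  have hV0 : 0 ≤ V := le_trans (sum_nonneg (fun _ _ => norm_nonneg _)) hV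
  rcases Nat.eq_zero_or_pos B with hB | hB
  · subst hB; simp; positivity
  rw [sum_range_mul_eq_abel B hB φ w]
  refine (norm_sub_le _ _).trans ?_
  have h1 : ‖φ (B - 1) * ∑ k ∈ range B, w k‖ ≤ M := by
    rw [norm_mul]
    calc ‖φ (B - 1)‖ * ‖∑ k ∈ range B, w k‖ ≤ 1 * M :=
          mul_le_mul (hφ _) (hM B le_rfl) (norm_nonneg _) zero_le_one
      _ = M := one_mul M
  have h2 : ‖∑ k ∈ range (B - 1), (φ (k + 1) - φ k) * ∑ i ∈ range (k + 1), w i‖ ≤ V * M := by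
    refine (norm_sum_le _ _).trans ?_
    calc ∑ k ∈ range (B - 1), ‖(φ (k + 1) - φ k) * ∑ i ∈ range (k + 1), w i‖
        ≤ ∑ k ∈ range (B - 1), ‖φ (k + 1) - φ k‖ * M := by
          refine sum_le_sum (fun k hk => ?_)
          rw [norm_mul]
          refine mul_le_mul_of_nonneg_left (hM (k + 1) ?_) (norm_nonneg _)
          rw [mem_range] at hk; omega
      _ = (∑ k ∈ range (B - 1), ‖φ (k + 1) - φ k‖) * M := by rw [sum_mul]
      _ ≤ V * M := mul_le_mul_of_nonneg_right hV hM0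
  linarith

/-- Reindexing an integer interval: `∑_{A < m ≤ A+n} F(m) = ∑_{k<n} F(A + k + 1)`. [folklore] -/
theorem sum_Ioc_eq_sum_range {M : Type*} [AddCommMonoid M] (F : ℤ → M) (A : ℤ) (n : ℕ) :
    ∑ m ∈ Ioc A (A + n), F m = ∑ k ∈ range n, F (A + k + 1) := by
  induction n with
  | zero => simp
  | succ n ih =>
      rw [sum_range_succ, ← ih]
      have h : Ioc A (A + (n + 1 : ℕ)) = insert (A + n + 1) (Ioc A (A + n)) := by
        ext m
        simp only [mem_Ioc, mem_insert, Nat.cast_add, Nat.cast_one]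
        omega
      rw [h, sum_insert (by simp), add_comm]

/-! ### The progressions of `c` -/

/-- **The `c` of one cube in one residue class form a progression**: for `L ≥ 1` and `c₀ ∈ ℤ`, if
`S = {c ∈ (t/10, t/10 + t/100] : c ≡ c₀ (mod L)}` is nonempty with least element `c_min`, then
`S = {c_min + Lk : k < B}` with `B = (⌊t/10 + t/100⌋ − c_min)/L + 1`.
[cite: HeathBrown2001LargestPrimeFactorCubic, §5 p. 571] -/
theorem filter_dvd_eq_image {t : ℝ} {L : ℕ} (hL : 0 < L) (c₀ : ℤ)
    (hne : ((bcRange t).filter fun c : ℕ => (L : ℤ) ∣ (c : ℤ) - c₀).Nonempty) :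
    ((bcRange t).filter fun c : ℕ => (L : ℤ) ∣ (c : ℤ) - c₀) =
      (range ((⌊t / 10 + t / 100⌋₊ - ((bcRange t).filter fun c : ℕ => (L : ℤ) ∣ (c : ℤ) - c₀).min' hne) / L + 1)).image
        fun k => ((bcRange t).filter fun c : ℕ => (L : ℤ) ∣ (c : ℤ) - c₀).min' hne + L * k := by
  set S := (bcRange t).filter fun c : ℕ => (L : ℤ) ∣ (c : ℤ) - c₀ with hS
  set cm := S.min' hne with hcm
  set cM := ⌊t / 10 + t / 100⌋₊ with hcM
  have hcmS : cm ∈ S := min'_mem S hne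
  have hcm1 := (mem_filter.1 hcmS)
  have hcm_range : cm ∈ bcRange t := hcm1.1
  rw [bcRange, mem_Ioc] at hcm_range
  ext c
  simp only [mem_image, mem_range]
  constructor
  · intro hc
    have hcS := mem_filter.1 hc
    have hc_range := hcS.1
    rw [bcRange, mem_Ioc] at hc_range
    have hle : cm ≤ c := min'_le S c hc
    have hdvd : L ∣ c - cm := by
      have h1 : (L : ℤ) ∣ (c : ℤ) - c₀ - ((cm : ℤ) - c₀) := dvd_sub hcS.2 hcm1.2
      have e : (c : ℤ) - c₀ - ((cm : ℤ) - c₀) = ((c - cm : ℕ) : ℤ) := by push_cast [Nat.cast_sub hle]; ring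
      rw [e] at h1
      exact_mod_cast h1
    obtain ⟨k, hk⟩ := hdvd
    refine ⟨k, ?_, by omega⟩
    have : k ≤ (cM - cm) / L := by
      rw [Nat.le_div_iff_mul_le hL]
      have : c - cm ≤ cM - cm := Nat.sub_le_sub_right hc_range.2 _
      rw [hk] at this; linarith [mul_comm L k]
    omega
  · rintro ⟨k, hk, rfl⟩
    have hk' : k ≤ (cM - cm) / L := by omega
    have hLk : L * k ≤ cM - cm := by
      have := Nat.div_mul_le_self (cM - cm) L
      nlinarith [Nat.mul_le_mul_left L hk']
    rw [mem_filter, bcRange, mem_Ioc]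
    refine ⟨⟨by omega, by omega⟩, ?_⟩
    have h1 : (L : ℤ) ∣ ((cm + L * k : ℕ) : ℤ) - cm := ⟨k, by push_cast; ring⟩
    have := dvd_add h1 hcm1.2
    have e : ((cm + L * k : ℕ) : ℤ) - cm + ((cm : ℤ) - c₀) = ((cm + L * k : ℕ) : ℤ) - c₀ := by ring
    rwa [e] at this

/-- The length of a progression: `(B − 1) L ≤ ⌊t/10 + t/100⌋ − c_min < t/100` and
`B ≤ t/(100 L) + 1`. [cite: HeathBrown2001LargestPrimeFactorCubic, §5 p. 571] -/
theorem card_progression_le {t : ℝ} (ht : 0 ≤ t) {L : ℕ} (hL : 0 < L) {cm : ℕ} (hcm : cm ∈ bcRange t) :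
    (((⌊t / 10 + t / 100⌋₊ - cm) / L : ℕ) : ℝ) * L < t / 100 ∧
      (((⌊t / 10 + t / 100⌋₊ - cm) / L + 1 : ℕ) : ℝ) ≤ t / (100 * L) + 1 := by
  obtain ⟨h1, -⟩ := mem_bcRange ht hcm
  have hcm2 : cm ≤ ⌊t / 10 + t / 100⌋₊ := (mem_Ioc.1 hcm).2
  have hfl : (⌊t / 10 + t / 100⌋₊ : ℝ) ≤ t / 10 + t / 100 := Nat.floor_le (by positivity)
  have hdiff : (((⌊t / 10 + t / 100⌋₊ - cm : ℕ)) : ℝ) < t / 100 := by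
    rw [Nat.cast_sub hcm2]; linarith
  have hdiv : (((⌊t / 10 + t / 100⌋₊ - cm) / L : ℕ) : ℝ) * L ≤ ((⌊t / 10 + t / 100⌋₊ - cm : ℕ) : ℝ) := by
    exact_mod_cast Nat.div_mul_le_self _ _
  have hL' : (0 : ℝ) < L := by exact_mod_cast hL
  constructor
  · linarith
  · push_cast
    have : (((⌊t / 10 + t / 100⌋₊ - cm) / L : ℕ) : ℝ) ≤ t / (100 * L) := by
      rw [le_div_iff₀ (by positivity)]
      nlinarith
    linarith

/-! ### The total variation of the smooth phase -/

/-- In the cube: `|N(a,b,c') − N(a,b,c)| ≤ t²|c' − c|` (`N(c') − N(c) = (c'−c)(4(c'²+c'c+c²) − 6ab)`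
and `|4(c'²+c'c+c²) − 6ab| ≤ 0.55t²`). [cite: HeathBrown2001LargestPrimeFactorCubic, (5.3)] -/
theorem abs_normf_sub_le {t : ℝ} (ht : 0 ≤ t) {a b c c' : ℕ} (ha : a ∈ aRange t) (hb : b ∈ bcRange t)
    (hc : c ∈ bcRange t) (hc' : c' ∈ bcRange t) :
    |(normf (a, b, c') : ℝ) - normf (a, b, c)| ≤ t ^ 2 * |(c' : ℝ) - c| := by
  obtain ⟨ha1, ha2⟩ := mem_aRange ht ha
  obtain ⟨hb1, hb2⟩ := mem_bcRange ht hb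
  obtain ⟨hc1, hc2⟩ := mem_bcRange ht hc
  obtain ⟨hc1', hc2'⟩ := mem_bcRange ht hc'
  have e : (normf (a, b, c') : ℝ) - normf (a, b, c) =
      ((c' : ℝ) - c) * (4 * ((c' : ℝ) ^ 2 + c' * c + (c : ℝ) ^ 2) - 6 * a * b) := by
    simp only [normf]; push_cast; ring
  rw [e, abs_mul, mul_comm]
  refine mul_le_mul_of_nonneg_right ?_ (abs_nonneg _)
  rw [abs_le]
  have hb0 : (0:ℝ) ≤ b := Nat.cast_nonneg b
  have hc0 : (0:ℝ) ≤ c := Nat.cast_nonneg c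
  have hc0' : (0:ℝ) ≤ c' := Nat.cast_nonneg c'
  constructor
  · nlinarith [mul_le_mul ha2 hb2 hb0 (by positivity), mul_nonneg hc0' hc0]
  · nlinarith [mul_le_mul hc2' hc2' hc0' (by positivity), mul_le_mul hc2' hc2 hc0 (by positivity),
      mul_le_mul hc2 hc2 hc0 (by positivity), mul_le_mul ha1.le hb1.le (by positivity) (by linarith),
      mul_nonneg ht ht]

/-- One step of the phase: `|e(hY/N') − e(hY/N)| ≤ 2π|h| Y |N − N'|/(N N')`. [folklore] -/
theorem norm_phase_step_le (h : ℤ) {Y N N' : ℝ} (hY : 0 ≤ Y) (hN : 0 < N) (hN' : 0 < N') :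
    ‖(𝐞 ((h : ℝ) * (Y / N')) : ℂ) - 𝐞 ((h : ℝ) * (Y / N))‖ ≤ 2 * π * |(h : ℝ)| * (Y * |N - N'| / (N * N')) := by
  refine (norm_fourierChar_sub_fourierChar_le _ _).trans (le_of_eq ?_)
  rw [← mul_sub, abs_mul, show Y / N' - Y / N = Y * (N - N') / (N * N') by field_simp,
    abs_div, abs_mul, abs_of_nonneg hY, abs_of_pos (mul_pos hN hN')]
  ring

/-- **The total variation of `Φ(k) = e(hY/N(a,b,c_k))` along a progression** `c_k = c_m + Lk`
(`k < B`) inside the cube, with `Y ≤ 2X` and `X ≤ t³`: `∑_{k<B−1} |Φ(k+1) − Φ(k)| ≤ (3/20)|h|`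
(each step is `≤ 2π|h|·2X·t²L/(0.93t³)²`, and `(B−1)L < t/100`).
[cite: HeathBrown2001LargestPrimeFactorCubic, §5 (5.3)] -/
theorem tv_phase_le {t : ℝ} (ht : 0 ≤ t) {X : ℕ} (hXt : (X : ℝ) ≤ t ^ 3) {Y : ℝ} (hY0 : 0 ≤ Y)
    (hY : Y ≤ 2 * X) {a b cm L B : ℕ} (ha : a ∈ aRange t) (hb : b ∈ bcRange t)
    (hmem : ∀ k < B, cm + L * k ∈ bcRange t) (hlen : (((B - 1 : ℕ)) : ℝ) * L < t / 100) (h : ℤ) :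
    ∑ k ∈ range (B - 1), ‖(𝐞 ((h : ℝ) * (Y / normf (a, b, cm + L * (k + 1)))) : ℂ) -
        𝐞 ((h : ℝ) * (Y / normf (a, b, cm + L * k)))‖ ≤ 3 / 20 * |(h : ℝ)| := by
  rcases Nat.lt_or_ge B 2 with hB | hB
  · have : B - 1 = 0 := by omega
    rw [this]; simp
  -- each step
  have ht0 : 0 < t := by
    have h0 := hmem 0 (by omega)
    obtain ⟨h1, h2⟩ := mem_bcRange ht h0
    linarith
  have hstep : ∀ k ∈ range (B - 1),
      ‖(𝐞 ((h : ℝ) * (Y / normf (a, b, cm + L * (k + 1)))) : ℂ) - 𝐞 ((h : ℝ) * (Y / normf (a, b, cm + L * k)))‖ ≤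
        2 * π * |(h : ℝ)| * (2 * X * (t ^ 2 * L) / ((93 / 100 * t ^ 3) * (93 / 100 * t ^ 3))) := by
    intro k hk
    rw [mem_range] at hk
    have hk1 : cm + L * k ∈ bcRange t := hmem k (by omega)
    have hk2 : cm + L * (k + 1) ∈ bcRange t := hmem (k + 1) (by omega)
    obtain ⟨hN1, -⟩ := normf_bounds ht ha hb hk1
    obtain ⟨hN2, -⟩ := normf_bounds ht ha hb hk2
    have hlow : (0 : ℝ) < 93 / 100 * t ^ 3 := by positivity
    have hN1pos : (0 : ℝ) < normf (a, b, cm + L * k) := hlow.trans hN1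
    have hN2pos : (0 : ℝ) < normf (a, b, cm + L * (k + 1)) := hlow.trans hN2
    refine (norm_phase_step_le h hY0 hN1pos hN2pos).trans ?_
    refine mul_le_mul_of_nonneg_left ?_ (by positivity)
    have hdiff := abs_normf_sub_le ht ha hb hk1 hk2
    have hcdiff : |((cm + L * (k + 1) : ℕ) : ℝ) - ((cm + L * k : ℕ) : ℝ)| = L := by
      push_cast
      rw [show (cm : ℝ) + L * (k + 1) - (cm + L * k) = L by ring, abs_of_nonneg (Nat.cast_nonneg L)]
    rw [hcdiff] at hdiff
    rw [abs_sub_comm] at hdiff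
    rw [div_le_div_iff₀ (mul_pos hN1pos hN2pos) (by positivity)]
    have hX0 : (0 : ℝ) ≤ X := Nat.cast_nonneg X
    have hL0 : (0 : ℝ) ≤ L := Nat.cast_nonneg L
    calc Y * |(normf (a, b, cm + L * k) : ℝ) - normf (a, b, cm + L * (k + 1))| *
          ((93 / 100 * t ^ 3) * (93 / 100 * t ^ 3))
        ≤ (2 * X) * (t ^ 2 * L) * ((93 / 100 * t ^ 3) * (93 / 100 * t ^ 3)) := by
          gcongr
      _ ≤ 2 * X * (t ^ 2 * L) * ((normf (a, b, cm + L * k) : ℝ) * normf (a, b, cm + L * (k + 1))) := by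
          gcongr
  refine (sum_le_sum hstep).trans ?_
  rw [sum_const, card_range, nsmul_eq_mul]
  -- `(B−1) · 2π|h| · 2X t² L/(0.93t³)² ≤ 2π|h| · 2 · (t/100) · t² · X /(0.8649 t⁶) ≤ 0.146 |h|`
  have hπ : π < 3.1416 := Real.pi_lt_d4
  have hX0 : (0 : ℝ) ≤ X := Nat.cast_nonneg X
  have ht6 : (0 : ℝ) < t ^ 6 := by positivity
  have key : ((B - 1 : ℕ) : ℝ) * (2 * X * (t ^ 2 * L) / ((93 / 100 * t ^ 3) * (93 / 100 * t ^ 3))) ≤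
      2 / 86 := by
    rw [show ((B - 1 : ℕ) : ℝ) * (2 * X * (t ^ 2 * L) / ((93 / 100 * t ^ 3) * (93 / 100 * t ^ 3))) =
      (2 * X * t ^ 2 * (((B - 1 : ℕ) : ℝ) * L)) / ((93 / 100) ^ 2 * t ^ 6) by ring]
    rw [div_le_div_iff₀ (by positivity) (by norm_num)]
    have h1 : 2 * (X : ℝ) * t ^ 2 * (((B - 1 : ℕ) : ℝ) * L) ≤ 2 * t ^ 3 * t ^ 2 * (t / 100) := by
      have hB0 : (0 : ℝ) ≤ ((B - 1 : ℕ) : ℝ) * L := by positivity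
      nlinarith [mul_nonneg (mul_nonneg (by norm_num : (0:ℝ) ≤ 2) hX0) (sq_nonneg t)]
    nlinarith
  calc ((B - 1 : ℕ) : ℝ) * (2 * π * |(h : ℝ)| * (2 * X * (t ^ 2 * L) / ((93 / 100 * t ^ 3) * (93 / 100 * t ^ 3))))
      = 2 * π * |(h : ℝ)| * (((B - 1 : ℕ) : ℝ) * (2 * X * (t ^ 2 * L) / ((93 / 100 * t ^ 3) * (93 / 100 * t ^ 3)))) := by
        ring
    _ ≤ 2 * π * |(h : ℝ)| * (2 / 86) := mul_le_mul_of_nonneg_left key (by positivity)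
    _ ≤ 3 / 20 * |(h : ℝ)| := by nlinarith [abs_nonneg (h : ℝ), Real.pi_pos]

end Literature.NumberTheory.Sieve.LargestPrimeFactorCubic
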